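import Literature.NumberTheory.DiophantineGeometry.GenEllDeFibres

/-!
# [GenEll] Thm 2.1 for `ℙ¹` (route piece W5-F-c): fibres of the FAMILY `t_c = 1/r + c·r^{k+1}/s` on
# `D_e : r^e = x(1−x)` — `E = t_c⁻¹(B)` and `X = x(E)` as `Finset`s, for every `c`

Support file for the cell's number-field-only proof architecture of `GenEllTwo` (stmt-ABC-19679;
S. Mochizuki, *Arithmetic elliptic curves in general position*, Math. J. Okayama Univ. **52**
(2010), Thm. 2.1 (ii) ⇒ (i), proof pp. 12–13; package map `GENELLTWO-P1ROUTE.md` of seat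
abc-iut-S6, §2 (B), §4, and S6's OWNER RULING #6 + AMENDMENT (2026-08-26T00:52/00:53Z): the
primary route uses the ONE-PARAMETER FAMILY `t_c := 1/r + c·r^{k+1}/s` (`c ∈ ℚ^×`), so that the
unprotectable finite sets `x(t_c⁻¹(crit t_c))` can be taken pairwise disjoint, and «W5 must be
stated for the family `t_c`»).  This file is the `c`-parametric twin of `GenEllDeFibres.lean` (the
case `c = 1`): every statement and proof is the one there with `c` threaded through; the curve
`curvePoly k = Y^{2k+1} − C(x(1−x))` and its irreducibility are imported from that file.

Conventions (S6 (D3) / L6-t16 W4a): `e = 2k+1`, affine coordinates `z = (x, r)` with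
`r^e = x(1−x)`, `s := 1 − 2x`, `T_c := s + c·r^{k+2}`, `t_c := T_c/(r·s) = 1/r + c·r^{k+1}/s`.
Away from the poles (`r = 0`: `Q_0, Q_1`; `s = 0`: the Weierstrass points) `t_c − b = D_{c,b}/(r s)`
with the POLYNOMIAL numerator `D_{c,b}(x, r) := c·r^{k+2} − b·r·(1 − 2x) + (1 − 2x)`, which does not
vanish at any pole when `c ≠ 0`.  Contents (names = those of `GenEllDeFibres` with suffix `C`):
`fibrePolyC`, `eval_fibrePolyC`, `not_dvd_fibrePolyC` (specialise `x = 0`: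
`Y^{2k+1} ∤ c·Y^{k+2} − bY + 1`, ANY `c`), `isCoprime_curvePoly_fibrePolyC`, `fibreC_finite` (every
field, every `c, b`), `fibreC_iff_t` (`c ≠ 0`), `EphiC k c B : Finset (F × F)` (`= t_c⁻¹(B)` for ANY
finite `B`, e.g. `B′_T = ρ_T⁻¹{0,1,∞}` of ruling #6), `XphiC k c B : Finset F`, membership lemmas,
`zero_not_mem_XphiC` / `one_not_mem_XphiC` (no cusps, any `c`), `map_mem_fibreC_iff`,
`isAlgebraic_of_mem_fibreC`, `exists_intermediateField_finiteDimensional_C`, `mem_range` (reused),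
`map_EphiC_eq`, `map_XphiC_eq`, `card_EphiC_eq`.  Classical; nothing here bears on [IUTchIII].
-/

namespace Literature.NumberTheory.DiophantineGeometry.GenEll.De

open Polynomial

universe u v w

section Polys

variable {K : Type u} [Field K] {F : Type v} [Field F] [Algebra K F]

/-- The numerator `D_{c,b}(x, Y) = c·Y^{k+2} − b(1−2x)·Y + (1−2x)` of `t_c − b`,
`t_c = (s + c·r^{k+2})/(r s)`, `s = 1 − 2x`, as a polynomial in `Y = r` over `K[x]` (the member `t_c` of
the family of ruling #6; `c = 1` is `fibrePoly`). [cite: MochizukiGenEll2010, Thm 2.1 proof p.12 (noncritical Belyi map), P1ROUTE §2 (B) / ruling #6 (family t_c)] -/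
noncomputable def fibrePolyC (k : ℕ) (c b : K) : K[X][X] :=
  C (C c) * X ^ (k + 2) - C (C b * (1 - 2 * X)) * X + C (1 - 2 * X)

/-- `fibrePolyC` evaluated at the `F`-point `(x, r)`: `c·r^{k+2} − b(1−2x)·r + (1−2x)`.
[cite: MochizukiGenEll2010, Thm 2.1 proof p.12, P1ROUTE §2 (B) / ruling #6] -/
theorem eval_fibrePolyC (k : ℕ) (c b : K) (x r : F) :
    ((fibrePolyC k c b).map (aeval x).toRingHom).eval r =
      algebraMap K F c * r ^ (k + 2) - algebraMap K F b * (1 - 2 * x) * r + (1 - 2 * x) := by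
  simp [fibrePolyC, Polynomial.map_sub, Polynomial.map_pow, Polynomial.map_mul, map_ofNat]

/-- `curvePoly ∤ fibrePolyC` for EVERY `c`: specialising `x = 0` would give
`Y^{2k+1} ∣ c·Y^{k+2} − b·Y + 1`, whose right-hand side has constant term `1`.
[cite: MochizukiGenEll2010, Thm 2.1 proof p.12, P1ROUTE §2 (B) / ruling #6] -/
theorem not_dvd_fibrePolyC (k : ℕ) (c b : K) : ¬ curvePoly k ∣ fibrePolyC k c b := by
  intro h
  have h0 := Polynomial.map_dvd (evalRingHom (0 : K)) h
  have hc : (curvePoly (K := K) k).map (evalRingHom 0) = X ^ (2 * k + 1) := by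
    simp [curvePoly, Polynomial.map_sub, Polynomial.map_pow]
  have hX : (X : K[X]) ∣ (fibrePolyC k c b).map (evalRingHom 0) :=
    (dvd_pow_self X (by omega)).trans (hc ▸ h0)
  rw [X_dvd_iff] at hX
  simp [fibrePolyC, Polynomial.map_sub, Polynomial.map_pow, Polynomial.map_mul, coeff_X,
    coeff_C] at hX

/-- The images of `curvePoly` and `fibrePolyC` in `K(x)[Y]` are coprime (Gauss's lemma).
[cite: MochizukiGenEll2010, Thm 2.1 proof p.12, P1ROUTE §2 (B) / ruling #6] -/
theorem isCoprime_curvePoly_fibrePolyC (k : ℕ) (c b : K) :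
    IsCoprime ((curvePoly k).map (algebraMap K[X] (RatFunc K)))
      ((fibrePolyC k c b).map (algebraMap K[X] (RatFunc K))) :=
  PlaneCurve.isCoprime_map_of_irreducible _ _ (monic_curvePoly k) (irreducible_curvePoly k)
    (not_dvd_fibrePolyC k c b)

end Polys

/-! ### Finiteness of the fibres and the finite sets `E`, `X` for `t_c` -/

section Fibres

variable {F : Type v} [Field F]

/-- **The fibre `t_c⁻¹(b)` on `D_e` is finite** (every field `F`, every `c b ∈ F`): the set of
`z = (x, r) ∈ F²` with `r^{2k+1} = x(1−x)` and `c·r^{k+2} − b(1−2x)r + (1−2x) = 0` is finite.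
[cite: MochizukiGenEll2010, Thm 2.1 proof p.12, P1ROUTE §4 (X_φ finite) / ruling #6] -/
theorem fibreC_finite (k : ℕ) (c b : F) :
    Set.Finite {z : F × F | z.2 ^ (2 * k + 1) = z.1 * (1 - z.1) ∧
      c * z.2 ^ (k + 2) - b * (1 - 2 * z.1) * z.2 + (1 - 2 * z.1) = 0} := by
  have h := PlaneCurve.finite_commonZeros (Ω := F) (curvePoly (K := F) k) (fibrePolyC k c b)
    (monic_curvePoly k) (by rw [natDegree_curvePoly]; omega) (isCoprime_curvePoly_fibrePolyC k c b)
  refine h.subset fun z hz => ?_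
  obtain ⟨h1, h2⟩ := hz
  refine ⟨?_, ?_⟩
  · rw [eval_curvePoly, sub_eq_zero]; exact h1
  · rw [eval_fibrePolyC]; simpa using h2

/-- On the curve and for `c ≠ 0`, `D_{c,b}(z) = 0` iff `z` is not a pole of `t_c` and `t_c(z) = b`,
where `t_c(x, r) = ((1−2x) + c·r^{k+2}) / (r·(1−2x))` (`D = s = ±1` at `r = 0`, `D = c·r^{k+2}` at
`s = 0`). [cite: MochizukiGenEll2010, Thm 2.1 proof p.12, P1ROUTE §2 (B) (poles of t) / ruling #6] -/
theorem fibreC_iff_t (k : ℕ) {c : F} (hc : c ≠ 0) (b : F) (z : F × F)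
    (hz : z.2 ^ (2 * k + 1) = z.1 * (1 - z.1)) :
    c * z.2 ^ (k + 2) - b * (1 - 2 * z.1) * z.2 + (1 - 2 * z.1) = 0 ↔
      z.2 ≠ 0 ∧ 1 - 2 * z.1 ≠ 0 ∧
        ((1 - 2 * z.1) + c * z.2 ^ (k + 2)) / (z.2 * (1 - 2 * z.1)) = b := by
  constructor
  · intro h
    have hr : z.2 ≠ 0 := by
      intro hr
      have hz' : z.1 * (1 - z.1) = 0 := by
        rw [← hz, hr]; exact zero_pow (by omega : 2 * k + 1 ≠ 0)
      have h' : 1 - 2 * z.1 = 0 := by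
        simpa [hr, zero_pow (by omega : k + 2 ≠ 0)] using h
      rcases mul_eq_zero.mp hz' with hx | hx
      · rw [hx] at h'; norm_num at h'
      · rw [sub_eq_zero] at hx; rw [← hx] at h'; norm_num at h'
    have hs : 1 - 2 * z.1 ≠ 0 := by
      intro hs
      rw [hs, mul_zero, zero_mul, sub_zero, add_zero] at h
      exact hr ((pow_eq_zero_iff (by omega : k + 2 ≠ 0)).mp ((mul_eq_zero.mp h).resolve_left hc))
    refine ⟨hr, hs, ?_⟩
    rw [div_eq_iff (mul_ne_zero hr hs)]
    linear_combination h
  · rintro ⟨hr, hs, ht⟩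
    rw [div_eq_iff (mul_ne_zero hr hs)] at ht
    linear_combination ht

/-- `E := t_c⁻¹(B)`, the finite set of affine points of `D_e` lying over the finite set `B` under `t_c`
(ruling #6: `B = B′_T = ρ_T⁻¹{0,1,∞} ⊇ crit(t_c)`, or any finite `B`), as a `Finset`.
[cite: MochizukiGenEll2010, Thm 2.1 proof p.12 (E := supp φ⁻¹), P1ROUTE §4 / ruling #6] -/
noncomputable def EphiC (k : ℕ) (c : F) (B : Finset F) : Finset (F × F) :=
  ((B.finite_toSet.biUnion fun b _ => fibreC_finite k c b).toFinset)

/-- Membership in `E`: `z` lies on `D_e` and `D_{c,b}(z) = 0` for some `b ∈ B`.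
[cite: MochizukiGenEll2010, Thm 2.1 proof p.12, P1ROUTE §4 / ruling #6] -/
theorem mem_EphiC {k : ℕ} {c : F} {B : Finset F} {z : F × F} :
    z ∈ EphiC k c B ↔ z.2 ^ (2 * k + 1) = z.1 * (1 - z.1) ∧
      ∃ b ∈ B, c * z.2 ^ (k + 2) - b * (1 - 2 * z.1) * z.2 + (1 - 2 * z.1) = 0 := by
  simp only [EphiC, Set.Finite.mem_toFinset, Set.mem_iUnion, Set.mem_setOf_eq, Finset.mem_coe,
    exists_prop]
  constructor
  · rintro ⟨b, hb, h1, h2⟩; exact ⟨h1, b, hb, h2⟩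
  · rintro ⟨h1, b, hb, h2⟩; exact ⟨b, hb, h1, h2⟩

/-- Membership in `E` via `t_c` (`c ≠ 0`): `z` on `D_e`, not a pole, and `t_c(z) ∈ B`.
[cite: MochizukiGenEll2010, Thm 2.1 proof p.12, P1ROUTE §4 / ruling #6] -/
theorem mem_EphiC_iff_t {k : ℕ} {c : F} (hc : c ≠ 0) {B : Finset F} {z : F × F} :
    z ∈ EphiC k c B ↔ z.2 ^ (2 * k + 1) = z.1 * (1 - z.1) ∧ z.2 ≠ 0 ∧ 1 - 2 * z.1 ≠ 0 ∧
      ((1 - 2 * z.1) + c * z.2 ^ (k + 2)) / (z.2 * (1 - 2 * z.1)) ∈ B := by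
  rw [mem_EphiC]
  constructor
  · rintro ⟨hz, b, hb, h⟩
    obtain ⟨hr, hs, ht⟩ := (fibreC_iff_t k hc b z hz).mp h
    exact ⟨hz, hr, hs, ht ▸ hb⟩
  · rintro ⟨hz, hr, hs, hB⟩
    exact ⟨hz, _, hB, (fibreC_iff_t k hc _ z hz).mpr ⟨hr, hs, rfl⟩⟩

/-- `X := x(E) ⊂ F`, the finite set of `x`-coordinates of `E = t_c⁻¹(B)`.
[cite: MochizukiGenEll2010, Thm 2.1 proof p.12, P1ROUTE §4 / ruling #6] -/
noncomputable def XphiC (k : ℕ) (c : F) (B : Finset F) : Finset F :=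
  open scoped Classical in (EphiC k c B).image Prod.fst

/-- Membership in `X`. [cite: MochizukiGenEll2010, Thm 2.1 proof p.12, P1ROUTE §4 / ruling #6] -/
theorem mem_XphiC {k : ℕ} {c : F} {B : Finset F} {x : F} :
    x ∈ XphiC k c B ↔ ∃ r : F, (x, r) ∈ EphiC k c B := by
  classical
  simp [XphiC, Finset.mem_image]

/-- **No cusps in `X`, I**: `0 ∉ X` (`x = 0 ⇒ r = 0 ⇒ D_{c,b} = 1 ≠ 0`; any `c`).
[cite: MochizukiGenEll2010, Thm 2.1 proof p.12 (φ noncritical at the cusps), P1ROUTE §4 («NO cusps») / ruling #6] -/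
theorem zero_not_mem_XphiC (k : ℕ) (c : F) (B : Finset F) : (0 : F) ∉ XphiC k c B := by
  rw [mem_XphiC]
  rintro ⟨r, hr⟩
  obtain ⟨hz, b, -, h⟩ := mem_EphiC.mp hr
  have h0 : r ^ (2 * k + 1) = 0 := by simpa using hz
  have hr0 : r = 0 := (pow_eq_zero_iff (by omega : 2 * k + 1 ≠ 0)).mp h0
  rw [hr0] at h
  norm_num [zero_pow (show k + 2 ≠ 0 by omega)] at h

/-- **No cusps in `X`, II**: `1 ∉ X` (`x = 1 ⇒ r = 0 ⇒ D_{c,b} = −1 ≠ 0`; any `c`).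
[cite: MochizukiGenEll2010, Thm 2.1 proof p.12 (φ noncritical at the cusps), P1ROUTE §4 («NO cusps») / ruling #6] -/
theorem one_not_mem_XphiC (k : ℕ) (c : F) (B : Finset F) : (1 : F) ∉ XphiC k c B := by
  rw [mem_XphiC]
  rintro ⟨r, hr⟩
  obtain ⟨hz, b, -, h⟩ := mem_EphiC.mp hr
  have h0 : r ^ (2 * k + 1) = 0 := by simpa using hz
  have hr0 : r = 0 := (pow_eq_zero_iff (by omega : 2 * k + 1 ≠ 0)).mp h0
  rw [hr0] at h
  norm_num [zero_pow (show k + 2 ≠ 0 by omega)] at h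

/-- **Functoriality**: a field homomorphism `φ : F → F'` maps the fibre of `t_c` over `b` into the
fibre of `t_{φ c}` over `φ b` and reflects it. [cite: MochizukiGenEll2010, Thm 2.1 proof p.12, P1ROUTE §4 / ruling #6] -/
theorem map_mem_fibreC_iff {F' : Type w} [Field F'] (φ : F →+* F') (k : ℕ) (c b : F) (z : F × F) :
    ((φ z.2) ^ (2 * k + 1) = φ z.1 * (1 - φ z.1) ∧
      φ c * (φ z.2) ^ (k + 2) - φ b * (1 - 2 * φ z.1) * φ z.2 + (1 - 2 * φ z.1) = 0) ↔
    (z.2 ^ (2 * k + 1) = z.1 * (1 - z.1) ∧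
      c * z.2 ^ (k + 2) - b * (1 - 2 * z.1) * z.2 + (1 - 2 * z.1) = 0) := by
  have h1 : (φ z.2) ^ (2 * k + 1) = φ z.1 * (1 - φ z.1) ↔ z.2 ^ (2 * k + 1) = z.1 * (1 - z.1) := by
    rw [← map_pow, ← map_one φ, ← map_sub, ← map_mul, φ.injective.eq_iff]
  have h2 : φ c * (φ z.2) ^ (k + 2) - φ b * (1 - 2 * φ z.1) * φ z.2 + (1 - 2 * φ z.1) = 0 ↔
      c * z.2 ^ (k + 2) - b * (1 - 2 * z.1) * z.2 + (1 - 2 * z.1) = 0 := by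
    rw [← map_eq_zero_iff φ φ.injective]
    simp [map_sub, map_mul, map_pow, map_ofNat]
  rw [h1, h2]

end Fibres

/-! ### Algebraicity: `E` is defined over a number field -/

section Algebraic

variable {K : Type u} [Field K] {F : Type v} [Field F] [Algebra K F]

/-- **Points of the fibre are algebraic** (`c, b ∈ K`, any field `F ⊇ K`): `x` is a root of the
nonzero resultant `Res_Y(curvePoly, fibrePolyC c b) ∈ K[x]`, and `r^{2k+1} = x(1−x)`.
[cite: MochizukiGenEll2010, Thm 2.1 proof p.12 (points of U_X(Q̄)), P1ROUTE §4 («X_φ ⊂ U(ℚ̄)») / ruling #6] -/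
theorem isAlgebraic_of_mem_fibreC (k : ℕ) (c b : K) (z : F × F)
    (hz : z.2 ^ (2 * k + 1) = z.1 * (1 - z.1))
    (hb : algebraMap K F c * z.2 ^ (k + 2) - algebraMap K F b * (1 - 2 * z.1) * z.2 +
      (1 - 2 * z.1) = 0) :
    IsAlgebraic K z.1 ∧ IsAlgebraic K z.2 := by
  have hx : IsAlgebraic K z.1 := by
    refine ⟨resultant (curvePoly k) (fibrePolyC k c b), ?_, ?_⟩
    · exact PlaneCurve.resultant_ne_zero_of_isCoprime_map _ _ (monic_curvePoly k)
        (isCoprime_curvePoly_fibrePolyC k c b)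
    · refine PlaneCurve.aeval_resultant_eq_zero_of_common_zero _ _
        (by rw [natDegree_curvePoly]; omega) z.1 z.2 ?_ ?_
      · rw [eval_curvePoly, sub_eq_zero]; exact hz
      · rw [eval_fibrePolyC]; exact hb
  refine ⟨hx, ?_⟩
  have hxi : IsIntegral K z.1 := hx.isIntegral
  have hpow : IsIntegral K (z.2 ^ (2 * k + 1)) := by
    rw [hz]
    exact hxi.mul (isIntegral_one.sub hxi)
  exact (hpow.of_pow (by omega)).isAlgebraic

/-- **`E` is defined over a finite extension of `K`** (`c ∈ K`, `B ⊂ K` embedded in `F ⊇ K`): all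
coordinates of the points of `E = t_c⁻¹(B) ⊂ F²` lie in ONE intermediate field `K'`, `K ⊆ K' ⊆ F`,
finite-dimensional over `K` — a number field when `K` is one (the field the W5 (C)/(G2)/modulus
consumers and W7 work over, per `(c, B)`). [cite: MochizukiGenEll2010, Thm 2.1 proof p.12, P1ROUTE §4 / ruling #6] -/
theorem exists_intermediateField_finiteDimensional_C (k : ℕ) (c : K) (B : Finset K) :
    ∃ K' : IntermediateField K F, FiniteDimensional K K' ∧
      ∀ z ∈ EphiC k (algebraMap K F c) (B.map ⟨algebraMap K F, (algebraMap K F).injective⟩),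
        z.1 ∈ K' ∧ z.2 ∈ K' := by
  classical
  set E := EphiC k (algebraMap K F c) (B.map ⟨algebraMap K F, (algebraMap K F).injective⟩) with hE
  let S : Set F := ↑(E.image Prod.fst ∪ E.image Prod.snd)
  haveI : Finite S := (Finset.finite_toSet _).to_subtype
  have hS : ∀ y ∈ S, IsIntegral K y := by
    intro y hy
    simp only [S, Finset.coe_union, Finset.coe_image, Set.mem_union, Set.mem_image,
      Finset.mem_coe] at hy
    rcases hy with ⟨z, hz, rfl⟩ | ⟨z, hz, rfl⟩
    all_goals
      obtain ⟨hcurve, b', hb', hfib⟩ := mem_EphiC.mp hz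
      obtain ⟨b, -, rfl⟩ := Finset.mem_map.mp hb'
      have halg := isAlgebraic_of_mem_fibreC k c b z hcurve hfib
    · exact halg.1.isIntegral
    · exact halg.2.isIntegral
  refine ⟨IntermediateField.adjoin K S, IntermediateField.finiteDimensional_adjoin hS, ?_⟩
  intro z hz
  constructor
  · exact IntermediateField.subset_adjoin K S
      (Finset.mem_coe.mpr (Finset.mem_union_left _ (Finset.mem_image_of_mem _ hz)))
  · exact IntermediateField.subset_adjoin K S
      (Finset.mem_coe.mpr (Finset.mem_union_right _ (Finset.mem_image_of_mem _ hz)))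

end Algebraic

/-! ### Independence of the algebraically closed field: `E(K̄) ≃ E(F)` -/

section Geometric

variable {K : Type u} [Field K] {Kbar : Type w} [Field Kbar] [Algebra K Kbar] [IsAlgClosed Kbar]
variable {F : Type v} [Field F] [Algebra K F]

/-- **`E` does not depend on the algebraically closed field** (`c ∈ K`, `B ⊂ K`): for any
`K`-algebra map `φ : K̄ → F` from an algebraically closed `K̄`, `φ × φ` maps `E(K̄) = t_c⁻¹(B)(K̄)`
bijectively onto `E(F)`. [cite: MochizukiGenEll2010, Thm 2.1 proof p.12 (E ⊂ Y(ℚ̄) viewed in Y(ℚ̄_v)), P1ROUTE §4 / ruling #6] -/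
theorem map_EphiC_eq (k : ℕ) (c : K) (B : Finset K) (φ : Kbar →ₐ[K] F) :
    (EphiC k (algebraMap K Kbar c) (B.map ⟨algebraMap K Kbar, (algebraMap K Kbar).injective⟩)).map
        ⟨fun w : Kbar × Kbar => (φ w.1, φ w.2),
          fun _ _ h => Prod.ext (φ.injective (congrArg Prod.fst h))
            (φ.injective (congrArg Prod.snd h))⟩ =
      EphiC k (algebraMap K F c) (B.map ⟨algebraMap K F, (algebraMap K F).injective⟩) := by
  ext z
  simp only [Finset.mem_map, Function.Embedding.coeFn_mk, mem_EphiC, Prod.exists]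
  constructor
  · rintro ⟨w1, w2, ⟨hcurve, b', hb', hfib⟩, rfl⟩
    obtain ⟨b, hb, rfl⟩ := hb'
    have hmap := (map_mem_fibreC_iff (φ : Kbar →+* F) k (algebraMap K Kbar c)
      (algebraMap K Kbar b) (w1, w2)).mpr ⟨hcurve, hfib⟩
    rw [AlgHom.coe_toRingHom, AlgHom.commutes, AlgHom.commutes] at hmap
    exact ⟨hmap.1, algebraMap K F b, ⟨b, hb, rfl⟩, hmap.2⟩
  · rintro ⟨hcurve, b', hb', hfib⟩
    obtain ⟨b, hb, rfl⟩ := hb'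
    obtain ⟨halg1, halg2⟩ := isAlgebraic_of_mem_fibreC k c b z hcurve hfib
    obtain ⟨w1, hw1⟩ := mem_range_of_isAlgebraic φ halg1
    obtain ⟨w2, hw2⟩ := mem_range_of_isAlgebraic φ halg2
    refine ⟨w1, w2, ?_, Prod.ext hw1 hw2⟩
    have hmap := (map_mem_fibreC_iff (φ : Kbar →+* F) k (algebraMap K Kbar c)
      (algebraMap K Kbar b) (w1, w2)).mp
    rw [AlgHom.coe_toRingHom, AlgHom.commutes, AlgHom.commutes] at hmap
    obtain ⟨h1, h2⟩ := hmap (by simp only [hw1, hw2]; exact ⟨hcurve, hfib⟩)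
    exact ⟨h1, algebraMap K Kbar b, ⟨b, hb, rfl⟩, h2⟩

/-- **`X` does not depend on the algebraically closed field**: `φ` maps `X(K̄)` bijectively onto
`X(F)` (`c ∈ K`, `B ⊂ K`). [cite: MochizukiGenEll2010, Thm 2.1 proof p.12, P1ROUTE §4 / ruling #6] -/
theorem map_XphiC_eq (k : ℕ) (c : K) (B : Finset K) (φ : Kbar →ₐ[K] F) :
    (XphiC k (algebraMap K Kbar c) (B.map ⟨algebraMap K Kbar, (algebraMap K Kbar).injective⟩)).map
        ⟨φ, φ.injective⟩ =
      XphiC k (algebraMap K F c) (B.map ⟨algebraMap K F, (algebraMap K F).injective⟩) := by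
  ext x
  simp only [Finset.mem_map, Function.Embedding.coeFn_mk, mem_XphiC]
  constructor
  · rintro ⟨x0, ⟨r0, hr0⟩, rfl⟩
    refine ⟨φ r0, ?_⟩
    rw [← map_EphiC_eq k c B φ, Finset.mem_map]
    exact ⟨(x0, r0), hr0, rfl⟩
  · rintro ⟨r, hr⟩
    rw [← map_EphiC_eq k c B φ, Finset.mem_map] at hr
    obtain ⟨w, hw, hwz⟩ := hr
    exact ⟨w.1, ⟨w.2, hw⟩, congrArg Prod.fst hwz⟩

/-- Consequently `#E` is the same over every algebraically closed field `F ⊇ K`.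
[cite: MochizukiGenEll2010, Thm 2.1 proof p.12, P1ROUTE §4 / ruling #6] -/
theorem card_EphiC_eq (k : ℕ) (c : K) (B : Finset K) (φ : Kbar →ₐ[K] F) :
    (EphiC k (algebraMap K Kbar c) (B.map ⟨algebraMap K Kbar, (algebraMap K Kbar).injective⟩)).card =
      (EphiC k (algebraMap K F c) (B.map ⟨algebraMap K F, (algebraMap K F).injective⟩)).card := by
  rw [← map_EphiC_eq k c B φ, Finset.card_map]

end Geometric

end Literature.NumberTheory.DiophantineGeometry.GenEll.De
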